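import Literature.MathematicalPhysics.QuantumFieldTheory.WilsonEnergyConvexity
import Literature.MathematicalPhysics.QuantumFieldTheory.StaticPotentialConcavity
import Literature.MathematicalPhysics.QuantumLattice.YangMillsClassical
import HarnessLib

/-!
# A volume-uniform weak-coupling floor for the Wilson plaquette, and the weak-coupling ceiling on
# the lattice string tension of infinite-volume limit states

Finite-volume Wilson lattice gauge theory on the torus `(ℤ/Lℤ)^d` with an ARBITRARY compact gauge
group `G` and a continuous UNITARY matrix representation `ρ : G →* M_N(ℂ)` (tree objects
`wilsonAction ρ U = Σ_p (N - Re tr ρ(U_p)) ≥ 0`, `wilsonMeasure`, `wilsonExpectation`,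
`torusLogPartition` of `ConstructiveQFTWave0` / `LatticeGaugeDLR`; the infinite-volume limit
states `infiniteVolumeLimitPoints ρ β`, loop expectations `rectExpectation`, static potential and
string tension of `QuantumLattice.WilsonLoops` / `StaticPotentialConcavity`).

Everything here is the elementary "free energy + convexity" mechanism, made VOLUME-UNIFORM by
restricting the product Haar integral to a product set (all statements PROVED, no definitions, no
named facts):

* `sub_re_trace_eq_half_norm_sub_one_sq` — for a unitary matrix, `N - Re tr U = ‖U - 1‖_F² / 2`
  (Frobenius norm); `norm_map_plaquetteHolonomy_sub_one_le` — `‖ρ(U_p) - 1‖_F ≤ Σ_{e ∈ ∂p}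
  ‖ρ(U_e) - 1‖_F` (unitary invariance of `‖·‖_F`), whence on the LINK BALL
  `A_r = {U : ‖ρ(U_e) - 1‖_F ≤ r ∀ e}` every plaquette costs at most `8 r²`
  (`plaquetteCost_le_of_forall_norm_le`) and `S ≤ 8 r² · #plaquettes`
  (`wilsonAction_le_of_forall_norm_le`);
* `measureReal_linkBall` — `Haar^{⊗E}(A_r) = φ_ρ(r)^{#E}` with the one-link small-ball function
  `φ_ρ(r) = Haar{g : ‖ρ(g) - 1‖_F ≤ r} > 0` (`measureReal_ball_pos`);
* `wilsonExpectation_wilsonAction_le_linkBall` — **the torus theorem**: for `β > 0`, `r > 0`,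
  every `d`, `L`,
  `⟨S⟩_{Λ_L,β} ≤ 8 r² · #plaquettes - #E · log φ_ρ(r) / β`
  (Gibbs–Jensen supporting line `β ⟨S⟩_β ≤ log Z(0) - log Z(β) = -log Z(β)` of
  `WilsonEnergyConvexity.mul_wilsonExpectation_wilsonAction_le`, `torusLogPartition_zero`, and
  `Z(β) ≥ e^{-8βr²·#P} Haar^{⊗E}(A_r)` from `exp_mul_measureReal_le_integral_exp`);
* `card_edge_eq_real`, `card_plaquette_eq_real`, `card_edge_div_card_plaquette` — `#E = d · L^d`,
  `#P = L^d · d(d-1)/2`, so `#E/#P = 2/(d-1)`; `wilsonExpectation_plaquetteCost_eq` — all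
  plaquettes of the torus have the same mean cost (translations
  `wilsonExpectation_comp_torusConfigShift` and axis permutations
  `wilsonExpectation_comp_configPerm`), `wilsonExpectation_wilsonAction_eq_card_mul`; hence **per
  plaquette** (`wilsonExpectation_plaquette_ge_linkBall`,
  `wilsonExpectation_wilsonLoop_one_one_ge_linkBall`): for every site `x` and axes `i ≠ j`,
  `⟨(1/N) Re tr ρ(U_{x,ij})⟩_{Λ_L,β} ≥ 1 - 8r²/N + 2 log φ_ρ(r) / ((d-1) N β)`,
  UNIFORMLY IN `L` — so the mean plaquette tends to `1` as `β → ∞` uniformly in the volume, for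
  every compact `G` (`r → 0` after `β → ∞`);
* **limit states** (`rectExpectation_one_one_ge_linkBall`): the same floor for `W_μ(1 × 1)` of
  every `μ ∈ infiniteVolumeLimitPoints ρ β`; `rectExpectation_ne_zero_of_one_one_pos` —
  `W_μ(1×1) > 0` alone gives `W_μ(R × T) ≠ 0` for all `R, T ≥ 1` (log-convexity from the
  degenerate loops, the tree's `rectExpectation_nonneg_and_logConvex` and its swap), i.e. the
  non-vanishing hypothesis `hW` of `StaticPotentialConcavity`; hence (`stringTension_le_linkBall`)
  for `β` so large that the floor is positive, EVERY limit state has a string tension `σ(μ) ≥ 0`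
  (tree: `StaticPotential.stringTension_nonneg_and_hasStringTension`) with the explicit
  **weak-coupling ceiling** `σ(μ) ≤ -log(1 - 8r²/N + 2 log φ_ρ(r)/((d-1)Nβ))`, and
  (`stringTension_le_of_weakCoupling`) for every `ε > 0` there is `β₀ > 0` with `0 ≤ σ(μ) ≤ ε`
  for all `β ≥ β₀` and all `μ ∈ infiniteVolumeLimitPoints ρ β`.

Honest placement. The mechanism (pressure convexity, Jensen, Laplace-type lower bound on `Z`) is
textbook [Friedli–Velenik 2017, Lemma 3.5 (p. 94) and App. B.8.1; Glimm–Jaffe 1987 §20.9 for the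
lattice gauge setting]; the sharp weak-coupling asymptotics of the mean plaquette for `U(N)`,
`β⟨N - Re tr U_p⟩ → N²/d`, is Chatterjee's free-energy theorem [arXiv:1602.01222, Thm. 2.1]
(tree, Summits side: `SoloBlind.weakCoupling_meanPlaquette`, an `∀ᶠ β, ∀ᶠ L` statement). The
present file is the crude but EXPLICIT and VOLUME-UNIFORM inequality for every compact group, every
`β > 0`, every `L` — the form needed to feed the non-vanishing hypothesis of the static-potential /
string-tension theorems of `StaticPotentialConcavity` at weak coupling. A volume-uniform
plaquette floor for non-abelian `G` at ARBITRARY `β` is not in print as a theorem (Griffiths'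
second inequality is open for non-abelian groups [Abdesselam, arXiv:2207.07603, p. 4]); for small
`β` the tree has `PlaquetteLowerBound.exists_rectExpectation_one_one_ge`. Nothing here is a
continuum statement; `σ` is the LATTICE string tension in lattice units.

## References

* S. Friedli, Y. Velenik, *Statistical Mechanics of Lattice Systems*, CUP 2017, Lemma 3.5 (p. 94:
  convexity of the finite-volume pressure) and Appendix B.8.1 (Jensen). [FriedliVelenik2017]
* S. Chatterjee, *The leading term of the Yang–Mills free energy*, J. Funct. Anal. 271 (2016),
  arXiv:1602.01222, Thm. 2.1. [arXiv160201222]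
* R. A. Horn, C. R. Johnson, *Matrix Analysis* (2013), Thm. 2.2.2 (unitary invariance of the
  Frobenius norm). [HornJohnson2013]
* E. Seiler, LNP 159 (1982), Ch. 2 (static potential, string tension from reflection positivity).
  [SeilerLNP1982]
-/

noncomputable section

open MeasureTheory Filter Topology
open scoped Matrix Matrix.Norms.Frobenius
open Literature.MathematicalPhysics.QuantumLattice Literature.Probability.LatticeModels

namespace Literature.MathematicalPhysics.QuantumFieldTheory

/-! ### Matrix algebra: plaquette cost versus Frobenius distance to `1` -/

section MatrixAlgebra

variable {N : ℕ}

/-- For a unitary matrix `U`, `N - Re tr U = ‖U - 1‖_F² / 2` (`‖U - 1‖_F² = tr((U-1)ᴴ(U-1)) =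
2N - 2 Re tr U`). [cite: HornJohnson2013, (0.2.5) and Thm 2.2.2] -/
theorem sub_re_trace_eq_half_norm_sub_one_sq {U : Matrix (Fin N) (Fin N) ℂ}
    (hU : U ∈ Matrix.unitaryGroup (Fin N) ℂ) :
    (N : ℝ) - U.trace.re = ‖U - 1‖ ^ 2 / 2 := by
  have hU' : Uᴴ * U = 1 := by
    rw [← Matrix.star_eq_conjTranspose]; exact Matrix.mem_unitaryGroup_iff'.1 hU
  have hsq : ‖U - 1‖ ^ 2 = RCLike.re ((U - 1)ᴴ * (U - 1)).trace :=
    Matrix.frobenius_norm_sq_eq_re_trace (U - 1)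
  have hexp : (U - 1)ᴴ * (U - 1) = 1 + 1 - Uᴴ - U := by
    rw [Matrix.conjTranspose_sub, Matrix.conjTranspose_one, Matrix.sub_mul, Matrix.mul_sub,
      Matrix.mul_sub, hU', Matrix.one_mul, Matrix.mul_one, Matrix.one_mul]
    abel
  have htr : RCLike.re ((U - 1)ᴴ * (U - 1)).trace = 2 * (N : ℝ) - 2 * U.trace.re := by
    rw [hexp, Matrix.trace_sub, Matrix.trace_sub, Matrix.trace_add, Matrix.trace_one,
      Matrix.trace_conjTranspose]
    simp only [Fintype.card_fin, map_sub, map_add, RCLike.re_to_complex, Complex.natCast_re,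
      Complex.star_def, Complex.conj_re]
    ring
  rw [hsq, htr]
  ring

/-- `‖A B - 1‖_F ≤ ‖A - 1‖_F + ‖B - 1‖_F` for unitary `A` (`A B - 1 = A (B - 1) + (A - 1)` and the
Frobenius norm is left unitarily invariant). [cite: HornJohnson2013, Thm 2.2.2] -/
theorem norm_mul_sub_one_le_of_mem_unitaryGroup {A B : Matrix (Fin N) (Fin N) ℂ}
    (hA : A ∈ Matrix.unitaryGroup (Fin N) ℂ) :
    ‖A * B - 1‖ ≤ ‖A - 1‖ + ‖B - 1‖ := by
  have h1 : A * B - 1 = A * (B - 1) + (A - 1) := by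
    rw [Matrix.mul_sub, Matrix.mul_one]; abel
  have h2 : ‖A * (B - 1)‖ = ‖B - 1‖ :=
    Matrix.frobenius_norm_unitaryGroup_mul ⟨A, hA⟩ (B - 1)
  calc ‖A * B - 1‖ = ‖A * (B - 1) + (A - 1)‖ := by rw [h1]
    _ ≤ ‖A * (B - 1)‖ + ‖A - 1‖ := norm_add_le _ _
    _ = ‖A - 1‖ + ‖B - 1‖ := by rw [h2, add_comm]

variable {G : Type*} [Group G] (ρ : G →* Matrix (Fin N) (Fin N) ℂ)

/-- For a unitary representation, `‖ρ(g⁻¹) - 1‖_F = ‖ρ(g) - 1‖_F` (right multiplication by the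
unitary `ρ(g)`). [cite: HornJohnson2013, Thm 2.2.2] -/
private theorem norm_map_inv_sub_one (hρU : ∀ g, ρ g ∈ Matrix.unitaryGroup (Fin N) ℂ) (g : G) :
    ‖ρ g⁻¹ - 1‖ = ‖ρ g - 1‖ := by
  have h : (ρ g⁻¹ - 1) * ρ g = 1 - ρ g := by
    rw [Matrix.sub_mul, Matrix.one_mul, ← map_mul, inv_mul_cancel, map_one]
  calc ‖ρ g⁻¹ - 1‖ = ‖(ρ g⁻¹ - 1) * ρ g‖ :=
        (Matrix.frobenius_norm_mul_unitaryGroup (ρ g⁻¹ - 1) ⟨ρ g, hρU g⟩).symm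
    _ = ‖1 - ρ g‖ := by rw [h]
    _ = ‖ρ g - 1‖ := norm_sub_rev _ _

variable {d L : ℕ}

/-- **The plaquette is close to `1` when its four links are**:
`‖ρ(U_{x,ij}) - 1‖_F ≤ ‖ρU(x,i) - 1‖ + ‖ρU(x+eᵢ,j) - 1‖ + ‖ρU(x+eⱼ,i) - 1‖ + ‖ρU(x,j) - 1‖`
for a unitary representation. [cite: HornJohnson2013, Thm 2.2.2] -/
theorem norm_map_plaquetteHolonomy_sub_one_le (hρU : ∀ g, ρ g ∈ Matrix.unitaryGroup (Fin N) ℂ)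
    (U : GaugeConfig d L G) (x : Site d L) (i j : Fin d) :
    ‖ρ (plaquetteHolonomy U x i j) - 1‖ ≤
      ‖ρ (U (x, i)) - 1‖ + ‖ρ (U (x.shift i, j)) - 1‖ + ‖ρ (U (x.shift j, i)) - 1‖ +
        ‖ρ (U (x, j)) - 1‖ := by
  have hmul : ∀ a b : G, ‖ρ (a * b) - 1‖ ≤ ‖ρ a - 1‖ + ‖ρ b - 1‖ := fun a b => by
    rw [map_mul]; exact norm_mul_sub_one_le_of_mem_unitaryGroup (hρU a)
  unfold plaquetteHolonomy
  calc ‖ρ (U (x, i) * U (x.shift i, j) * (U (x.shift j, i))⁻¹ * (U (x, j))⁻¹) - 1‖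
      ≤ ‖ρ (U (x, i) * U (x.shift i, j) * (U (x.shift j, i))⁻¹) - 1‖ + ‖ρ (U (x, j))⁻¹ - 1‖ :=
        hmul _ _
    _ ≤ ‖ρ (U (x, i) * U (x.shift i, j)) - 1‖ + ‖ρ (U (x.shift j, i))⁻¹ - 1‖ +
          ‖ρ (U (x, j))⁻¹ - 1‖ := by gcongr; exact hmul _ _
    _ ≤ ‖ρ (U (x, i)) - 1‖ + ‖ρ (U (x.shift i, j)) - 1‖ + ‖ρ (U (x.shift j, i))⁻¹ - 1‖ +
          ‖ρ (U (x, j))⁻¹ - 1‖ := by gcongr; exact hmul _ _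
    _ = _ := by rw [norm_map_inv_sub_one ρ hρU, norm_map_inv_sub_one ρ hρU]

/-- On the link ball `{U : ‖ρ(U_e) - 1‖_F ≤ r ∀ e}` every plaquette costs at most `8 r²`:
`N - Re tr ρ(U_p) = ‖ρ(U_p) - 1‖_F²/2 ≤ (4r)²/2`. [cite: HornJohnson2013, Thm 2.2.2] -/
theorem plaquetteCost_le_of_forall_norm_le (hρU : ∀ g, ρ g ∈ Matrix.unitaryGroup (Fin N) ℂ)
    {r : ℝ} {U : GaugeConfig d L G} (hU : ∀ e, ‖ρ (U e) - 1‖ ≤ r) (x : Site d L) (i j : Fin d) :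
    (N : ℝ) - (ρ (plaquetteHolonomy U x i j)).trace.re ≤ 8 * r ^ 2 := by
  have hr : 0 ≤ r := (norm_nonneg _).trans (hU (x, i))
  have h4 : ‖ρ (plaquetteHolonomy U x i j) - 1‖ ≤ 4 * r := by
    have := norm_map_plaquetteHolonomy_sub_one_le ρ hρU U x i j
    linarith [hU (x, i), hU (x.shift i, j), hU (x.shift j, i), hU (x, j)]
  rw [sub_re_trace_eq_half_norm_sub_one_sq (hρU _)]
  have h0 : 0 ≤ ‖ρ (plaquetteHolonomy U x i j) - 1‖ := norm_nonneg _
  nlinarith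

/-- On the link ball of radius `r` the Wilson action is at most `8 r² · #plaquettes`.
[cite: HornJohnson2013, Thm 2.2.2] -/
theorem wilsonAction_le_of_forall_norm_le [NeZero L]
    (hρU : ∀ g, ρ g ∈ Matrix.unitaryGroup (Fin N) ℂ)
    {r : ℝ} {U : GaugeConfig d L G} (hU : ∀ e, ‖ρ (U e) - 1‖ ≤ r) :
    wilsonAction ρ U ≤ 8 * r ^ 2 * Fintype.card (Plaquette d L) := by
  unfold wilsonAction
  calc ∑ p : Plaquette d L, ((N : ℝ) - (ρ (plaquetteHolonomy U p.1 p.2.1.1 p.2.1.2)).trace.re)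
      ≤ ∑ _p : Plaquette d L, 8 * r ^ 2 :=
        Finset.sum_le_sum fun p _ => plaquetteCost_le_of_forall_norm_le ρ hρU hU _ _ _
    _ = 8 * r ^ 2 * Fintype.card (Plaquette d L) := by
        rw [Finset.sum_const, Finset.card_univ, nsmul_eq_mul, mul_comm]

end MatrixAlgebra

/-! ### The link ball: product Haar measure and positivity -/

section LinkBall

variable {d L N : ℕ} {G : Type*} [Group G] [TopologicalSpace G] [IsTopologicalGroup G]
  [CompactSpace G] [MeasurableSpace G] [BorelSpace G] (ρ : G →* Matrix (Fin N) (Fin N) ℂ)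

omit [IsTopologicalGroup G] [CompactSpace G] in
/-- The one-link ball `{g : ‖ρ(g) - 1‖_F ≤ r}` is closed (continuous `ρ`), hence measurable.
[folklore] -/
private theorem measurableSet_ball (hρ : Continuous ρ) (r : ℝ) :
    MeasurableSet {g : G | ‖ρ g - 1‖ ≤ r} :=
  (isClosed_le ((continuous_norm.comp (hρ.sub continuous_const))) continuous_const).measurableSet

/-- **The one-link small-ball function is positive**: `φ_ρ(r) = Haar{g : ‖ρ(g) - 1‖_F ≤ r} > 0`
for `r > 0` (it contains the open neighbourhood `{‖ρ(g) - 1‖ < r}` of `1`, and Haar measure charges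
open sets). [folklore] -/
private theorem measureReal_ball_pos (hρ : Continuous ρ) {r : ℝ} (hr : 0 < r) :
    0 < (haarProbability G).real {g : G | ‖ρ g - 1‖ ≤ r} := by
  haveI : (haarProbability G).IsOpenPosMeasure := by unfold haarProbability; infer_instance
  have hopen : IsOpen {g : G | ‖ρ g - 1‖ < r} :=
    isOpen_lt (continuous_norm.comp (hρ.sub continuous_const)) continuous_const
  have hne : ({g : G | ‖ρ g - 1‖ < r}).Nonempty := ⟨1, by simpa using hr⟩
  have hpos := hopen.measure_pos (haarProbability G) hne
  have hsub : {g : G | ‖ρ g - 1‖ < r} ⊆ {g : G | ‖ρ g - 1‖ ≤ r} := fun g (hg : _ < r) => le_of_lt hg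
  exact ENNReal.toReal_pos (ne_of_gt (hpos.trans_le (measure_mono hsub))) (measure_ne_top _ _)

/-- **Product Haar measure of the link ball**: `Haar^{⊗E}{U : ‖ρ(U_e) - 1‖ ≤ r ∀ e} = φ_ρ(r)^{#E}`.
[folklore] -/
private theorem measureReal_linkBall [NeZero L] (r : ℝ) :
    (Measure.pi fun _ : Edge d L => haarProbability G).real
        {U : GaugeConfig d L G | ∀ e, ‖ρ (U e) - 1‖ ≤ r} =
      (haarProbability G).real {g : G | ‖ρ g - 1‖ ≤ r} ^ Fintype.card (Edge d L) := by
  have hset : {U : GaugeConfig d L G | ∀ e, ‖ρ (U e) - 1‖ ≤ r} =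
      Set.pi Set.univ fun _ : Edge d L => {g : G | ‖ρ g - 1‖ ≤ r} := by
    ext U; simp
  rw [measureReal_def, hset, Measure.pi_pi]
  rw [Finset.prod_const, Finset.card_univ, ENNReal.toReal_pow, measureReal_def]

end LinkBall

/-! ### The torus theorem: the mean action at weak coupling, uniformly in the volume -/

section Torus

variable {d L N : ℕ} {G : Type*} [Group G] [TopologicalSpace G] [IsTopologicalGroup G]
  [CompactSpace G] [MeasurableSpace G] [BorelSpace G] (ρ : G →* Matrix (Fin N) (Fin N) ℂ)

/-- `log Z_{Λ,0} = 0` (`Z(0) = ∫ dHaar^{⊗E} = 1`). [folklore] -/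
private theorem torusLogPartition_zero [NeZero L] (hρ : Continuous ρ) :
    torusLogPartition d ρ 0 L = 0 := by
  rw [torusLogPartition_eq_log_integral ρ hρ]
  simp

/-- **The mean Wilson action at weak coupling, uniformly in the volume.** For a compact group `G`,
a continuous unitary representation `ρ`, every `d`, `L`, `β > 0` and every radius `r > 0`,
`⟨S⟩_{Λ_L,β} ≤ 8 r² · #plaquettes(Λ_L) - #E(Λ_L) · log φ_ρ(r) / β`, `φ_ρ(r) = Haar{‖ρ(g)-1‖_F ≤ r}`:
the supporting line of the convex `log Z` between `0` and `β` (`β⟨S⟩_β ≤ log Z(0) - log Z(β)`,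
Gibbs–Jensen) and the restriction of the Haar integral to the link ball
(`Z(β) ≥ e^{-8βr²#P} φ_ρ(r)^{#E}`) — an elementary consequence of the cited convexity / Jensen
mechanism, not printed in this form. [cite: FriedliVelenik2017, Lemma 3.5 (p. 94), App. B.8.1] -/
theorem wilsonExpectation_wilsonAction_le_linkBall [NeZero L] (hρ : Continuous ρ)
    (hρU : ∀ g, ρ g ∈ Matrix.unitaryGroup (Fin N) ℂ) {β : ℝ} (hβ : 0 < β) {r : ℝ} (hr : 0 < r) :
    wilsonExpectation ρ β (wilsonAction (d := d) (L := L) (G := G) ρ) ≤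
      8 * r ^ 2 * Fintype.card (Plaquette d L) -
        Fintype.card (Edge d L) * Real.log ((haarProbability G).real {g : G | ‖ρ g - 1‖ ≤ r}) / β := by
  set π₀ : Measure (GaugeConfig d L G) := Measure.pi fun _ : Edge d L => haarProbability G with hπ₀
  set ε : ℝ := 8 * r ^ 2 * Fintype.card (Plaquette d L) with hε
  set φ : ℝ := (haarProbability G).real {g : G | ‖ρ g - 1‖ ≤ r} with hφ
  have hφpos : 0 < φ := measureReal_ball_pos ρ hρ hr
  -- supporting line between `0` and `β`
  have hsl := mul_wilsonExpectation_wilsonAction_le (d := d) (L := L) (G := G) ρ hρ β 0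
  rw [torusLogPartition_zero ρ hρ, sub_zero, zero_sub, torusLogPartition_eq_log_integral ρ hρ β]
    at hsl
  -- `Z(β) ≥ e^{-βε} Haar^{⊗E}{S ≤ ε} ≥ e^{-βε} φ^{#E}`
  have hZ1 := exp_mul_measureReal_le_integral_exp (d := d) (L := L) (G := G) ρ hρ hβ.le ε
  have hsub : {U : GaugeConfig d L G | ∀ e, ‖ρ (U e) - 1‖ ≤ r} ⊆
      {U : GaugeConfig d L G | wilsonAction ρ U ≤ ε} :=
    fun U hU => wilsonAction_le_of_forall_norm_le ρ hρU hU
  have hmono : φ ^ Fintype.card (Edge d L) ≤ π₀.real {U : GaugeConfig d L G | wilsonAction ρ U ≤ ε} := by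
    rw [hφ, ← measureReal_linkBall ρ r]
    exact measureReal_mono hsub
  have hZ2 : Real.exp (-β * ε) * φ ^ Fintype.card (Edge d L) ≤
      ∫ U, Real.exp (-β * wilsonAction ρ U) ∂π₀ :=
    (mul_le_mul_of_nonneg_left hmono (Real.exp_pos _).le).trans hZ1
  have hpow : 0 < φ ^ Fintype.card (Edge d L) := pow_pos hφpos _
  have hlog : -β * ε + Fintype.card (Edge d L) * Real.log φ ≤
      Real.log (∫ U, Real.exp (-β * wilsonAction ρ U) ∂π₀) := by
    have h := Real.log_le_log (mul_pos (Real.exp_pos _) hpow) hZ2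
    rwa [Real.log_mul (Real.exp_pos _).ne' hpow.ne', Real.log_exp, Real.log_pow] at h
  -- combine
  set E : ℝ := wilsonExpectation ρ β (wilsonAction (d := d) (L := L) (G := G) ρ) with hE
  have h1 : β * E ≤ β * ε - Fintype.card (Edge d L) * Real.log φ := by linarith
  have h2 : β * E ≤ β * (ε - Fintype.card (Edge d L) * Real.log φ / β) := by
    rw [mul_sub, mul_div_cancel₀ _ hβ.ne']
    exact h1
  exact le_of_mul_le_mul_left h2 hβ

end Torus

/-! ### Counting: `#E = d L^d`, `2 #P = d(d-1) L^d` -/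

section Counting

/-- `2 · #{(i, j) : i < j} = d² - d` in `Fin d × Fin d` (the strict upper and lower triangles are
in bijection by the swap and together form the off-diagonal). [folklore] -/
private theorem two_mul_card_planes (d : ℕ) :
    2 * Fintype.card {q : Fin d × Fin d // q.1 < q.2} = d * d - d := by
  classical
  set s : Finset (Fin d × Fin d) := Finset.univ.filter fun q => q.1 < q.2 with hs
  set t : Finset (Fin d × Fin d) := Finset.univ.filter fun q => q.2 < q.1 with ht
  have hcard : Fintype.card {q : Fin d × Fin d // q.1 < q.2} = s.card := Fintype.card_subtype _
  have hst : t.card = s.card := by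
    refine Finset.card_equiv (Equiv.prodComm (Fin d) (Fin d)) fun q => ?_
    simp only [ht, hs, Finset.mem_filter, Finset.mem_univ, true_and, Equiv.prodComm_apply,
      Prod.fst_swap, Prod.snd_swap]
  have hunion : s ∪ t = (Finset.univ : Finset (Fin d)).offDiag := by
    ext q
    simp only [hs, ht, Finset.mem_union, Finset.mem_filter, Finset.mem_univ, true_and,
      Finset.mem_offDiag]
    exact ⟨fun h => h.elim ne_of_lt fun h' => (ne_of_lt h').symm, fun h => lt_or_gt_of_ne h⟩
  have hdisj : Disjoint s t := by
    rw [hs, ht, Finset.disjoint_filter]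
    exact fun q _ h1 h2 => lt_asymm h1 h2
  have hu := Finset.card_union_of_disjoint hdisj
  rw [hunion, Finset.offDiag_card, Finset.card_univ, Fintype.card_fin, hst] at hu
  omega

/-- As a real number, `#{(i, j) : i < j} = d(d-1)/2`. [folklore] -/
private theorem card_planes_eq (d : ℕ) :
    (Fintype.card {q : Fin d × Fin d // q.1 < q.2} : ℝ) = (d : ℝ) * ((d : ℝ) - 1) / 2 := by
  have h := two_mul_card_planes d
  have hle : d ≤ d * d := Nat.le_mul_self d
  have h' : 2 * (Fintype.card {q : Fin d × Fin d // q.1 < q.2} : ℝ) = (d : ℝ) * d - d := by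
    have := congrArg (fun n : ℕ => (n : ℝ)) h
    simpa [Nat.cast_sub hle] using this
  linarith

/-- `#plaquettes((ℤ/Lℤ)^d) = L^d · d(d-1)/2`. [folklore] -/
private theorem card_plaquette_eq_real (d L : ℕ) [NeZero L] :
    (Fintype.card (Plaquette d L) : ℝ) = (L : ℝ) ^ d * ((d : ℝ) * ((d : ℝ) - 1) / 2) := by
  rw [← card_planes_eq]
  simp [Plaquette, Site, Fintype.card_prod, Fintype.card_pi, ZMod.card, Finset.prod_const,
    Finset.card_univ, Fintype.card_fin]

/-- `#E((ℤ/Lℤ)^d) = L^d · d`. [folklore] -/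
private theorem card_edge_eq_real (d L : ℕ) [NeZero L] :
    (Fintype.card (Edge d L) : ℝ) = (L : ℝ) ^ d * d := by
  simp [Edge, Site, Fintype.card_prod, Fintype.card_pi, ZMod.card, Finset.prod_const,
    Finset.card_univ, Fintype.card_fin]

/-- `#E / #P = 2/(d-1)` on the torus `(ℤ/Lℤ)^d`, `d ≥ 2`. [folklore] -/
private theorem card_edge_div_card_plaquette {d : ℕ} (hd : 2 ≤ d) (L : ℕ) [NeZero L] :
    (Fintype.card (Edge d L) : ℝ) / Fintype.card (Plaquette d L) = 2 / ((d : ℝ) - 1) := by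
  rw [card_edge_eq_real, card_plaquette_eq_real]
  have hd' : (2 : ℝ) ≤ d := by exact_mod_cast hd
  have hL : (0 : ℝ) < (L : ℝ) ^ d := by
    have : (0 : ℝ) < L := by exact_mod_cast Nat.pos_of_ne_zero (NeZero.ne L)
    positivity
  have hd1 : (d : ℝ) - 1 ≠ 0 := by linarith
  have hd0 : (d : ℝ) ≠ 0 := by linarith
  field_simp

end Counting

/-! ### Per plaquette: all plaquettes have the same mean cost -/

section PerPlaquette

variable {d L N : ℕ} {G : Type*} [Group G] [TopologicalSpace G] [IsTopologicalGroup G]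
  [CompactSpace G] [MeasurableSpace G] [BorelSpace G] (ρ : G →* Matrix (Fin N) (Fin N) ℂ)

omit [CompactSpace G] in
/-- The cost `U ↦ N - Re tr ρ(U_{x,ij})` of one plaquette is measurable for the product σ-algebra
(continuous `ρ`; no countability assumption on `G`, via `WilsonRP.EntryMeasurable`). [folklore] -/
private theorem measurable_plaquetteCostAt (hρ : Continuous ρ) (x : Site d L) (i j : Fin d) :
    Measurable fun U : GaugeConfig d L G => (N : ℝ) - (ρ (plaquetteHolonomy U x i j)).trace.re := by
  have h : Measurable fun U : GaugeConfig d L G => (ρ (plaquetteHolonomy U x i j)).trace.re := by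
    unfold plaquetteHolonomy
    exact ((((WilsonRP.entryMeasurable_apply hρ _).mul (WilsonRP.entryMeasurable_apply hρ _)).mul
      (WilsonRP.entryMeasurable_apply_inv hρ _)).mul
        (WilsonRP.entryMeasurable_apply_inv hρ _)).measurable_trace_re
  exact measurable_const.sub h

omit [MeasurableSpace G] [BorelSpace G] in
/-- `|N - Re tr ρ(U_{x,ij})| ≤ 2N`. [folklore] -/
private theorem abs_plaquetteCostAt_le (hρ : Continuous ρ) (U : GaugeConfig d L G) (x : Site d L)
    (i j : Fin d) : |(N : ℝ) - (ρ (plaquetteHolonomy U x i j)).trace.re| ≤ 2 * N := by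
  have h := Literature.RepresentationTheory.CompactGroups.CompactGroup.abs_re_trace_le_card ρ hρ
    (plaquetteHolonomy U x i j)
  have h' : |(ρ (plaquetteHolonomy U x i j)).trace.re| ≤ N := by simpa using h
  have hN : (0 : ℝ) ≤ N := Nat.cast_nonneg _
  rw [abs_le] at h' ⊢
  constructor <;> linarith [h'.1, h'.2]

/-- The cost of one plaquette is integrable for the torus Wilson measure. [folklore] -/
private theorem integrable_plaquetteCostAt [NeZero L] (hρ : Continuous ρ) (β : ℝ) (x : Site d L)
    (i j : Fin d) :
    Integrable (fun U : GaugeConfig d L G => (N : ℝ) - (ρ (plaquetteHolonomy U x i j)).trace.re)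
      (wilsonMeasure ρ β) := by
  haveI := isProbabilityMeasure_wilsonMeasure (d := d) (L := L) (G := G) ρ hρ β
  exact Integrable.of_bound (measurable_plaquetteCostAt ρ hρ x i j).aestronglyMeasurable (2 * N)
    (ae_of_all _ fun U => by rw [Real.norm_eq_abs]; exact abs_plaquetteCostAt_le ρ hρ U x i j)

/-- Two distinct axes can be moved to any two distinct axes by a permutation. [folklore] -/
private theorem exists_perm_apply_eq {i j i' j' : Fin d} (hij : i ≠ j) (hij' : i' ≠ j') :
    ∃ π : Equiv.Perm (Fin d), π i = i' ∧ π j = j' := by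
  classical
  set σ₁ : Equiv.Perm (Fin d) := Equiv.swap i i' with hσ₁
  have h1 : σ₁ i = i' := by simp [hσ₁]
  have h2 : σ₁ j ≠ i' := by
    intro h
    have : j = i := by
      have := congrArg σ₁.symm h
      simpa [hσ₁, Equiv.swap_apply_left] using this
    exact hij this.symm
  set σ₂ : Equiv.Perm (Fin d) := Equiv.swap (σ₁ j) j' with hσ₂
  refine ⟨σ₁.trans σ₂, ?_, ?_⟩
  · rw [Equiv.trans_apply, h1, hσ₂, Equiv.swap_apply_of_ne_of_ne h2.symm hij']
  · rw [Equiv.trans_apply]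
    simp [hσ₂]

/-- **All plaquettes of the torus have the same mean cost** `⟨N - Re tr ρ(U_{x,ij})⟩_{Λ_L,β}`
(`i ≠ j`, `i' ≠ j'`): lattice translations (`wilsonExpectation_comp_torusConfigShift`) move the
base point, axis permutations (`wilsonExpectation_comp_configPerm`) the plane — the internal energy
`E = ⟨1 - (1/tr 1) tr U_p⟩` "equals the expectation value of the contribution of a single plaquette
to the action" on the periodic lattice. [cite: MontvayMunster1994, §3.2 (3.113), PDF p. 123; §3.4 (3.348), PDF p. 147 (translation invariance, periodic b.c.)] -/
theorem wilsonExpectation_plaquetteCost_eq [NeZero L] (hρ : Continuous ρ) (β : ℝ)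
    {x x' : Site d L} {i j i' j' : Fin d} (hij : i ≠ j) (hij' : i' ≠ j') :
    wilsonExpectation ρ β (fun U : GaugeConfig d L G =>
        (N : ℝ) - (ρ (plaquetteHolonomy U x i j)).trace.re) =
      wilsonExpectation ρ β (fun U : GaugeConfig d L G =>
        (N : ℝ) - (ρ (plaquetteHolonomy U x' i' j')).trace.re) := by
  -- move the plane by a permutation `π` with `π⁻¹ i = i'`, `π⁻¹ j = j'`
  obtain ⟨π, hπi, hπj⟩ := exists_perm_apply_eq (d := d) hij hij'
  have hperm : wilsonExpectation ρ β (fun U : GaugeConfig d L G =>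
        (N : ℝ) - (ρ (plaquetteHolonomy U x i j)).trace.re) =
      wilsonExpectation ρ β (fun U : GaugeConfig d L G =>
        (N : ℝ) - (ρ (plaquetteHolonomy U (sitePerm π.symm.symm x) i' j')).trace.re) := by
    rw [← wilsonExpectation_comp_configPerm ρ hρ β π.symm]
    congr 1
    funext U
    simp only [Function.comp_apply, plaquetteHolonomy_configPerm, Equiv.symm_symm, hπi, hπj]
  rw [hperm]
  -- move the base point by a translation
  set y : Site d L := sitePerm π.symm.symm x with hy
  rw [← wilsonExpectation_comp_torusConfigShift ρ β (x' - y)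
    (fun U : GaugeConfig d L G => (N : ℝ) - (ρ (plaquetteHolonomy U x' i' j')).trace.re)]
  congr 1
  funext U
  simp only [Function.comp_apply, plaquetteHolonomy_torusConfigShift, sub_sub_cancel]

/-- The mean action is `#plaquettes` times the internal energy `E = ⟨N - Re tr ρ(U_p)⟩` of any one
plaquette (`i ≠ j`) on the periodic lattice. [cite: MontvayMunster1994, §3.2 (3.113), PDF p. 123] -/
theorem wilsonExpectation_wilsonAction_eq_card_mul [NeZero L] (hρ : Continuous ρ) (β : ℝ)
    (x : Site d L) {i j : Fin d} (hij : i ≠ j) :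
    wilsonExpectation ρ β (wilsonAction (d := d) (L := L) (G := G) ρ) =
      Fintype.card (Plaquette d L) *
        wilsonExpectation ρ β (fun U : GaugeConfig d L G =>
          (N : ℝ) - (ρ (plaquetteHolonomy U x i j)).trace.re) := by
  haveI := isProbabilityMeasure_wilsonMeasure (d := d) (L := L) (G := G) ρ hρ β
  have hint : ∀ p : Plaquette d L, Integrable (fun U : GaugeConfig d L G =>
      (N : ℝ) - (ρ (plaquetteHolonomy U p.1 p.2.1.1 p.2.1.2)).trace.re) (wilsonMeasure ρ β) :=
    fun p => integrable_plaquetteCostAt ρ hρ β p.1 p.2.1.1 p.2.1.2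
  have hsum : wilsonExpectation ρ β (wilsonAction (d := d) (L := L) (G := G) ρ) =
      ∑ p : Plaquette d L, wilsonExpectation ρ β (fun U : GaugeConfig d L G =>
        (N : ℝ) - (ρ (plaquetteHolonomy U p.1 p.2.1.1 p.2.1.2)).trace.re) := by
    simp only [wilsonExpectation]
    rw [← integral_finsetSum _ fun p _ => hint p]
    rfl
  rw [hsum, Finset.sum_congr rfl fun p _ =>
    wilsonExpectation_plaquetteCost_eq ρ hρ β (x := p.1) (x' := x) (ne_of_lt p.2.2) hij,
    Finset.sum_const, Finset.card_univ, nsmul_eq_mul]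

/-- **The plaquette floor at weak coupling, uniformly in the volume.** For a compact group `G`, a
continuous unitary `N`-dimensional representation `ρ` (`N ≥ 1`), `d ≥ 2`, every torus size `L`,
every `β > 0`, `r > 0`, every site `x` and axes `i ≠ j`:
`⟨(1/N) Re tr ρ(U_{x,ij})⟩_{Λ_L,β} ≥ 1 - 8r²/N + 2 log φ_ρ(r) / ((d-1) N β)`,
`φ_ρ(r) = Haar{g : ‖ρ(g) - 1‖_F ≤ r} ∈ (0, 1]` (so the last term is `≤ 0` and tends to `0` as
`β → ∞`): the mean plaquette (internal energy (3.113) of Montvay–Münster) tends to `1` at weak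
coupling UNIFORMLY in `L` (elementary; the sharp `U(N)` asymptotics `β E → N²/d` is Chatterjee's
theorem, not used here). [cite: FriedliVelenik2017, Lemma 3.5 (p. 94), App. B.8.1]
[cite: MontvayMunster1994, §3.2 (3.113), PDF p. 123] [cite: arXiv160201222, Thm. 2.1] -/
theorem wilsonExpectation_plaquette_ge_linkBall [NeZero L] (hd : 2 ≤ d) (hN : 1 ≤ N)
    (hρ : Continuous ρ) (hρU : ∀ g, ρ g ∈ Matrix.unitaryGroup (Fin N) ℂ) {β : ℝ} (hβ : 0 < β)
    {r : ℝ} (hr : 0 < r) (x : Site d L) {i j : Fin d} (hij : i ≠ j) :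
    1 - 8 * r ^ 2 / N +
        2 * Real.log ((haarProbability G).real {g : G | ‖ρ g - 1‖ ≤ r}) / (((d : ℝ) - 1) * N * β) ≤
      wilsonExpectation ρ β (fun U : GaugeConfig d L G =>
        (N : ℝ)⁻¹ * (ρ (plaquetteHolonomy U x i j)).trace.re) := by
  haveI := isProbabilityMeasure_wilsonMeasure (d := d) (L := L) (G := G) ρ hρ β
  set φ : ℝ := (haarProbability G).real {g : G | ‖ρ g - 1‖ ≤ r} with hφ
  set c : ℝ := wilsonExpectation ρ β (fun U : GaugeConfig d L G =>
    (N : ℝ) - (ρ (plaquetteHolonomy U x i j)).trace.re) with hc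
  have hP : (0 : ℝ) < Fintype.card (Plaquette d L) := by
    rw [card_plaquette_eq_real]
    have hd' : (2 : ℝ) ≤ d := by exact_mod_cast hd
    have : (0 : ℝ) < L := by exact_mod_cast Nat.pos_of_ne_zero (NeZero.ne L)
    have h1 : (0 : ℝ) < (d : ℝ) * ((d : ℝ) - 1) / 2 := by nlinarith
    positivity
  -- the mean cost of one plaquette
  have hmain := wilsonExpectation_wilsonAction_le_linkBall (d := d) (L := L) ρ hρ hρU hβ hr
  rw [wilsonExpectation_wilsonAction_eq_card_mul ρ hρ β x hij] at hmain
  have hc_le : c ≤ 8 * r ^ 2 - 2 / ((d : ℝ) - 1) * Real.log φ / β := by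
    have h1 : c ≤ (8 * r ^ 2 * Fintype.card (Plaquette d L) -
        Fintype.card (Edge d L) * Real.log φ / β) / Fintype.card (Plaquette d L) := by
      rw [le_div_iff₀ hP, mul_comm]; exact hmain
    have h2 : (8 * r ^ 2 * Fintype.card (Plaquette d L) -
        Fintype.card (Edge d L) * Real.log φ / β) / Fintype.card (Plaquette d L) =
        8 * r ^ 2 - (Fintype.card (Edge d L) : ℝ) / Fintype.card (Plaquette d L) * Real.log φ / β := by
      field_simp
    rw [h2, card_edge_div_card_plaquette hd L] at h1
    exact h1
  -- translate to the normalised trace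
  have hN0 : (0 : ℝ) < N := by exact_mod_cast hN
  have hrel : wilsonExpectation ρ β (fun U : GaugeConfig d L G =>
      (N : ℝ)⁻¹ * (ρ (plaquetteHolonomy U x i j)).trace.re) = 1 - c / N := by
    have hint : Integrable (fun U : GaugeConfig d L G =>
        (N : ℝ) - (ρ (plaquetteHolonomy U x i j)).trace.re) (wilsonMeasure ρ β) :=
      integrable_plaquetteCostAt ρ hρ β x i j
    have hfun : (fun U : GaugeConfig d L G => (N : ℝ)⁻¹ * (ρ (plaquetteHolonomy U x i j)).trace.re) =
        fun U => 1 - (N : ℝ)⁻¹ * ((N : ℝ) - (ρ (plaquetteHolonomy U x i j)).trace.re) := by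
      funext U; field_simp; ring
    rw [hfun]
    simp only [wilsonExpectation] at hc ⊢
    rw [integral_sub (integrable_const _) (hint.const_mul _), integral_const, probReal_univ,
      one_smul, integral_const_mul, ← hc, div_eq_inv_mul]
  rw [hrel]
  have h3 : c / N ≤ (8 * r ^ 2 - 2 / ((d : ℝ) - 1) * Real.log φ / β) / N :=
    div_le_div_of_nonneg_right hc_le hN0.le
  have h4 : (8 * r ^ 2 - 2 / ((d : ℝ) - 1) * Real.log φ / β) / N =
      8 * r ^ 2 / N - 2 * Real.log φ / (((d : ℝ) - 1) * N * β) := by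
    have hd1 : (d : ℝ) - 1 ≠ 0 := by
      have : (2 : ℝ) ≤ d := by exact_mod_cast hd
      linarith
    field_simp
  rw [h4] at h3
  linarith

/-- The same floor for the `1 × 1` Wilson loop `wilsonLoop ρ x i j 1 1` (whose holonomy is the
plaquette holonomy). [cite: FriedliVelenik2017, Lemma 3.5 (p. 94), App. B.8.1] -/
theorem wilsonExpectation_wilsonLoop_one_one_ge_linkBall [NeZero L] (hd : 2 ≤ d) (hN : 1 ≤ N)
    (hρ : Continuous ρ) (hρU : ∀ g, ρ g ∈ Matrix.unitaryGroup (Fin N) ℂ) {β : ℝ} (hβ : 0 < β)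
    {r : ℝ} (hr : 0 < r) (x : Site d L) {i j : Fin d} (hij : i ≠ j) :
    1 - 8 * r ^ 2 / N +
        2 * Real.log ((haarProbability G).real {g : G | ‖ρ g - 1‖ ≤ r}) / (((d : ℝ) - 1) * N * β) ≤
      wilsonExpectation ρ β (wilsonLoop ρ x i j 1 1) := by
  have h : wilsonLoop ρ x i j 1 1 = fun U : GaugeConfig d L G =>
      (N : ℝ)⁻¹ * (ρ (plaquetteHolonomy U x i j)).trace.re := by
    funext U
    simp [wilsonLoop, rectangleHolonomy, lineHolonomy, plaquetteHolonomy, Site.shift]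
  rw [h]
  exact wilsonExpectation_plaquette_ge_linkBall ρ hd hN hρ hρU hβ hr x hij

/-- **The mean plaquette tends to one at weak coupling, uniformly in the volume**: for every
`ε > 0` there is `β₀ > 0` such that for all `β ≥ β₀`, ALL torus sizes `L`, all sites `x` and axes
`i ≠ j`, `⟨(1/N) Re tr ρ(U_{x,ij})⟩_{Λ_L,β} ≥ 1 - ε` (compact `G`, continuous unitary `ρ`, `N ≥ 1`,
`d ≥ 2`). Choice: `8r²/N = ε/2`, then `β₀` with `-2 log φ_ρ(r)/((d-1)Nβ₀) ≤ ε/2`. (The internal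
energy `E = ⟨1 - (1/N) Re tr U_p⟩` of Montvay–Münster (3.113) is `≤ ε` at weak coupling, uniformly
in the volume; elementary, not printed in this form.)
[cite: MontvayMunster1994, §3.2 (3.113), PDF p. 123] [cite: FriedliVelenik2017, Lemma 3.5 (p. 94), App. B.8.1] -/
theorem wilsonExpectation_plaquette_ge_one_sub_of_weakCoupling (hd : 2 ≤ d) (hN : 1 ≤ N)
    (hρ : Continuous ρ) (hρU : ∀ g, ρ g ∈ Matrix.unitaryGroup (Fin N) ℂ) {ε : ℝ} (hε : 0 < ε) :
    ∃ β₀ : ℝ, 0 < β₀ ∧ ∀ β : ℝ, β₀ ≤ β → ∀ (L : ℕ) [NeZero L] (x : Site d L) (i j : Fin d),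
      i ≠ j → 1 - ε ≤ wilsonExpectation ρ β (fun U : GaugeConfig d L G =>
        (N : ℝ)⁻¹ * (ρ (plaquetteHolonomy U x i j)).trace.re) := by
  have hN0 : (0 : ℝ) < N := by exact_mod_cast hN
  have hd1 : (0 : ℝ) < (d : ℝ) - 1 := by
    have : (2 : ℝ) ≤ d := by exact_mod_cast hd
    linarith
  set r : ℝ := Real.sqrt (ε * N / 16) with hr
  have hr0 : 0 < r := Real.sqrt_pos.2 (by positivity)
  have hr2 : 8 * r ^ 2 / N = ε / 2 := by
    rw [hr, Real.sq_sqrt (by positivity)]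
    field_simp
    ring
  set φ : ℝ := (haarProbability G).real {g : G | ‖ρ g - 1‖ ≤ r} with hφ
  have hφ0 : 0 < φ := measureReal_ball_pos ρ hρ hr0
  have hφ1 : φ ≤ 1 := measureReal_le_one
  have hlog : Real.log φ ≤ 0 := Real.log_nonpos hφ0.le hφ1
  set K : ℝ := ((d : ℝ) - 1) * N with hK
  have hK0 : 0 < K := by positivity
  set β₀ : ℝ := max 1 (-4 * Real.log φ / (ε * K)) with hβ₀
  refine ⟨β₀, lt_of_lt_of_le one_pos (le_max_left _ _), fun β hβ L _ x i j hij => ?_⟩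
  have hβpos : 0 < β := lt_of_lt_of_le (lt_of_lt_of_le one_pos (le_max_left _ _)) hβ
  have hterm : -(ε / 2) ≤ 2 * Real.log φ / (((d : ℝ) - 1) * N * β) := by
    have h1 : -4 * Real.log φ / (ε * K) ≤ β := (le_max_right _ _).trans hβ
    rw [div_le_iff₀ (by positivity)] at h1
    rw [le_div_iff₀ (by positivity), ← hK]
    rw [hK] at h1
    linarith
  have hmain := wilsonExpectation_plaquette_ge_linkBall (L := L) ρ hd hN hρ hρU hβpos hr0 x hij
  rw [hr2] at hmain
  linarith

end PerPlaquette

/-! ### Infinite-volume limit states: plaquette floor, non-vanishing loops, string tension -/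

section Limit

variable {d N : ℕ} {G : Type*} [Group G] [TopologicalSpace G] [IsTopologicalGroup G]
  [CompactSpace G] [MeasurableSpace G] [BorelSpace G] (ρ : G →* Matrix (Fin N) (Fin N) ℂ)
variable [NeZero d]

/-- **Plaquette floor for every infinite-volume limit state** (weak limit of the torus bound,
which is uniform in `L`): for `μ ∈ infiniteVolumeLimitPoints ρ β`, `β > 0`, `r > 0`,
`W_μ(1 × 1) ≥ 1 - 8r²/N + 2 log φ_ρ(r)/((d-1)Nβ)`.
[cite: FriedliVelenik2017, Lemma 3.5 (p. 94), App. B.8.1] [cite: SeilerLNP1982, Ch. 2] -/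
theorem rectExpectation_one_one_ge_linkBall (hd : 2 ≤ d) (hN : 1 ≤ N) (hρ : Continuous ρ)
    (hρU : ∀ g, ρ g ∈ Matrix.unitaryGroup (Fin N) ℂ) {β : ℝ} (hβ : 0 < β) {r : ℝ} (hr : 0 < r)
    {μ : Measure (LGConfig d G)} (hμ : μ ∈ infiniteVolumeLimitPoints ρ β) :
    1 - 8 * r ^ 2 / N +
        2 * Real.log ((haarProbability G).real {g : G | ‖ρ g - 1‖ ≤ r}) / (((d : ℝ) - 1) * N * β) ≤
      rectExpectation μ (fun g => normalisedCharacter N (ρ g)) 0 1 1 1 := by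
  obtain ⟨φ, hφ, hlim⟩ := hμ
  have h01 : (0 : Fin d) ≠ 1 := by
    intro h
    have := congrArg Fin.val h
    have hd' : 1 % d = 1 := Nat.mod_eq_of_lt (by omega)
    simp [hd'] at this
  refine ge_of_tendsto' (tendsto_wilsonExpectation_wilsonLoop ρ hρ hlim 1 1) fun k => ?_
  exact wilsonExpectation_wilsonLoop_one_one_ge_linkBall (L := φ k + 1) ρ hd hN hρ hρU hβ hr 0 h01

omit [BorelSpace G] in
/-- `W_μ(R × 0) = 1` for a probability measure `μ`, continuous `ρ` and `N ≥ 1` (the degenerate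
rectangle in the second slot, by the coordinate swap from `rectExpectation_zero_eq_one`).
[folklore] -/
private theorem rectExpectation_snd_zero_eq_one' (hρ : Continuous ρ) (hN : N ≠ 0)
    (μ : Measure (LGConfig d G)) [IsProbabilityMeasure μ] (R : ℕ) :
    rectExpectation μ (fun g => normalisedCharacter N (ρ g)) 0 1 R 0 = 1 := by
  set χ : G → ℝ := fun g => normalisedCharacter N (ρ g) with hχ
  have hχinv : ∀ g, χ g⁻¹ = χ g := fun g => by
    simp only [hχ, normalisedCharacter,
      Literature.RepresentationTheory.CompactGroups.CompactGroup.re_trace_map_inv ρ hρ]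
  haveI : IsProbabilityMeasure (μ.map (configPermZd (G := G) (Equiv.swap (0 : Fin d) 1))) :=
    Measure.isProbabilityMeasure_map (configPermZd _).measurable.aemeasurable
  rw [rectExpectation_eq_swap μ χ hχinv R 0]
  exact rectExpectation_zero_eq_one ρ hN _ 0 1 R

/-- **A positive plaquette alone makes every rectangular loop expectation non-zero**: for a limit
state `μ` (`d ≥ 2`, `β ≥ 0`), `0 < W_μ(1 × 1)` implies `W_μ(R × T) ≠ 0` (indeed `> 0`) for all
`R, T ≥ 1` — log-convexity in `T` at `R = 1` from `W(1,0) = 1`, then in `R` at each `T` from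
`W(0,T) = 1` (the tree's `rectExpectation_nonneg_and_logConvex` and its swap). This is exactly the
non-vanishing hypothesis `hW` of the static-potential / string-tension theorems of
`StaticPotentialConcavity`. [cite: SeilerLNP1982, Ch. 2] -/
theorem rectExpectation_ne_zero_of_one_one_pos (hd : 2 ≤ d) (hρ : Continuous ρ) {β : ℝ}
    (hβ : 0 ≤ β) {μ : Measure (LGConfig d G)} (hμ : μ ∈ infiniteVolumeLimitPoints ρ β)
    (h11 : 0 < rectExpectation μ (fun g => normalisedCharacter N (ρ g)) 0 1 1 1) :
    ∀ R T, 1 ≤ R → 1 ≤ T → rectExpectation μ (fun g => normalisedCharacter N (ρ g)) 0 1 R T ≠ 0 := by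
  obtain ⟨φ, hφ, hlim⟩ := hμ
  haveI : IsProbabilityMeasure μ := hlim.1
  set W : ℕ → ℕ → ℝ := fun R T => rectExpectation μ (fun g => normalisedCharacter N (ρ g)) 0 1 R T
    with hWdef
  have hN : N ≠ 0 := by
    rintro rfl
    simp [rectExpectation, loopExpectation, wilsonLoopObs, normalisedCharacter] at h11
  -- log-convexity in the second slot (time direction after the swap) and in the first slot
  have hsnd : ∀ R T, 0 ≤ W R T ∧ W R (T + 1) ^ 2 ≤ W R T * W R (T + 2) := fun R T =>
    StaticPotential.rectExpectation_nonneg_and_logConvex_snd ρ hd hρ hβ hφ hlim R T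
  have hfst : ∀ R T, 0 ≤ W R T ∧ W (R + 1) T ^ 2 ≤ W R T * W (R + 2) T := fun R T =>
    rectExpectation_nonneg_and_logConvex ρ hd hρ hβ hφ hlim T R
  have hR0 : ∀ T, W 0 T = 1 := fun T => rectExpectation_zero_eq_one ρ hN μ 0 1 T
  -- positivity propagates along a log-convex non-negative sequence from two positive entries
  have key : ∀ a : ℕ → ℝ, (∀ n, 0 ≤ a n) → (∀ n, a (n + 1) ^ 2 ≤ a n * a (n + 2)) →
      0 < a 0 → 0 < a 1 → ∀ n, 0 < a n := by
    intro a h0 hconv ha0 ha1 n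
    induction n using Nat.strong_induction_on with
    | _ n ih =>
      match n with
      | 0 => exact ha0
      | 1 => exact ha1
      | k + 2 =>
        have hk1 : 0 < a (k + 1) := ih (k + 1) (by omega)
        have hk : 0 < a k := ih k (by omega)
        by_contra hneg
        have hzero : a (k + 2) = 0 := le_antisymm (not_lt.1 hneg) (h0 _)
        have := hconv k
        rw [hzero, mul_zero] at this
        exact absurd this (not_le.2 (by positivity))
  -- `W(1, T) > 0` for all `T`
  have h1T : ∀ T, 0 < W 1 T := by
    refine key (fun T => W 1 T) (fun T => (hsnd 1 T).1) (fun T => (hsnd 1 T).2) ?_ ?_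
    · change 0 < rectExpectation μ (fun g => normalisedCharacter N (ρ g)) 0 1 1 0
      rw [rectExpectation_snd_zero_eq_one' ρ hρ hN μ 1]
      exact one_pos
    · exact h11
  intro R T hR hT
  have hpos : 0 < W R T :=
    key (fun R => W R T) (fun R => (hfst R T).1) (fun R => (hfst R T).2)
      (by rw [hR0]; exact one_pos) (h1T T) R
  exact hpos.ne'

/-- **The weak-coupling ceiling on the lattice string tension of every limit state.** For a
compact group `G`, a continuous unitary `N`-dimensional representation (`N ≥ 1`), `d ≥ 2`,
`β > 0` and a radius `r > 0` at which the plaquette floor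
`f = 1 - 8r²/N + 2 log φ_ρ(r)/((d-1)Nβ)` is POSITIVE, every infinite-volume limit state
`μ ∈ infiniteVolumeLimitPoints ρ β` HAS a string tension `σ(μ) ≥ 0` (tree: log-convexity /
Fekete, `StaticPotentialConcavity`, whose non-vanishing hypothesis is discharged by
`rectExpectation_ne_zero_of_one_one_pos`) and `σ(μ) ≤ -log f` (`σ ≤ V(1) ≤ -log W(1×1)`,
`W(1×1) ≥ f`). [cite: SeilerLNP1982, Ch. 2] [cite: FriedliVelenik2017, Lemma 3.5 (p. 94), App. B.8.1] -/
theorem stringTension_le_linkBall (hd : 2 ≤ d) (hN : 1 ≤ N) (hρ : Continuous ρ)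
    (hρU : ∀ g, ρ g ∈ Matrix.unitaryGroup (Fin N) ℂ) {β : ℝ} (hβ : 0 < β) {r : ℝ} (hr : 0 < r)
    (hfloor : 0 < 1 - 8 * r ^ 2 / N +
        2 * Real.log ((haarProbability G).real {g : G | ‖ρ g - 1‖ ≤ r}) / (((d : ℝ) - 1) * N * β))
    {μ : Measure (LGConfig d G)} (hμ : μ ∈ infiniteVolumeLimitPoints ρ β) :
    HasStringTension μ (fun g => normalisedCharacter N (ρ g))
        (stringTension μ (fun g => normalisedCharacter N (ρ g))) ∧
      0 ≤ stringTension μ (fun g => normalisedCharacter N (ρ g)) ∧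
      stringTension μ (fun g => normalisedCharacter N (ρ g)) ≤
        -Real.log (1 - 8 * r ^ 2 / N +
          2 * Real.log ((haarProbability G).real {g : G | ‖ρ g - 1‖ ≤ r}) /
            (((d : ℝ) - 1) * N * β)) := by
  have h11 := rectExpectation_one_one_ge_linkBall ρ hd hN hρ hρU hβ hr hμ
  have hpos : 0 < rectExpectation μ (fun g => normalisedCharacter N (ρ g)) 0 1 1 1 :=
    hfloor.trans_le h11
  have hW := rectExpectation_ne_zero_of_one_one_pos ρ hd hρ hβ.le hμ hpos
  obtain ⟨hσ0, hσ⟩ :=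
    StaticPotential.stringTension_nonneg_and_hasStringTension ρ hd hρ hβ.le hμ hW
  refine ⟨hσ, hσ0, ?_⟩
  refine (StaticPotential.stringTension_le_neg_log_plaquette ρ hd hρ hβ.le hμ hW).trans ?_
  exact neg_le_neg (Real.log_le_log hfloor h11)

/-- **The lattice string tension tends to zero at weak coupling, uniformly over the limit
states**: for every `ε > 0` there is `β₀ > 0` such that for all `β ≥ β₀` EVERY
`μ ∈ infiniteVolumeLimitPoints ρ β` has a string tension with `0 ≤ σ(μ) ≤ ε` (compact `G`,
continuous unitary `ρ`, `N ≥ 1`, `d ≥ 2`; `σ` in lattice units). Choice: `δ = 1 - e^{-ε}`,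
`8r²/N = δ/2`, then `β₀` with `-2 log φ_ρ(r)/((d-1)Nβ₀) ≤ δ/2`.
[cite: SeilerLNP1982, Ch. 2] [cite: FriedliVelenik2017, Lemma 3.5 (p. 94), App. B.8.1] -/
theorem stringTension_le_of_weakCoupling (hd : 2 ≤ d) (hN : 1 ≤ N) (hρ : Continuous ρ)
    (hρU : ∀ g, ρ g ∈ Matrix.unitaryGroup (Fin N) ℂ) {ε : ℝ} (hε : 0 < ε) :
    ∃ β₀ : ℝ, 0 < β₀ ∧ ∀ β : ℝ, β₀ ≤ β → ∀ μ ∈ infiniteVolumeLimitPoints (d := d) ρ β,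
      HasStringTension μ (fun g => normalisedCharacter N (ρ g))
          (stringTension μ (fun g => normalisedCharacter N (ρ g))) ∧
        0 ≤ stringTension μ (fun g => normalisedCharacter N (ρ g)) ∧
        stringTension μ (fun g => normalisedCharacter N (ρ g)) ≤ ε := by
  set δ : ℝ := 1 - Real.exp (-ε) with hδ
  have hexp1 : Real.exp (-ε) < 1 := Real.exp_lt_one_iff.2 (by linarith)
  have hδ0 : 0 < δ := by rw [hδ]; linarith
  have hN0 : (0 : ℝ) < N := by exact_mod_cast hN
  have hd1 : (0 : ℝ) < (d : ℝ) - 1 := by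
    have : (2 : ℝ) ≤ d := by exact_mod_cast hd
    linarith
  set r : ℝ := Real.sqrt (δ * N / 16) with hr
  have hr0 : 0 < r := Real.sqrt_pos.2 (by positivity)
  have hr2 : 8 * r ^ 2 / N = δ / 2 := by
    rw [hr, Real.sq_sqrt (by positivity)]
    field_simp
    ring
  set φ : ℝ := (haarProbability G).real {g : G | ‖ρ g - 1‖ ≤ r} with hφ
  have hφ0 : 0 < φ := measureReal_ball_pos ρ hρ hr0
  have hφ1 : φ ≤ 1 := measureReal_le_one
  have hlog : Real.log φ ≤ 0 := Real.log_nonpos hφ0.le hφ1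
  set K : ℝ := ((d : ℝ) - 1) * N with hK
  have hK0 : 0 < K := by positivity
  set β₀ : ℝ := max 1 (-4 * Real.log φ / (δ * K)) with hβ₀
  refine ⟨β₀, lt_of_lt_of_le one_pos (le_max_left _ _), fun β hβ μ hμ => ?_⟩
  have hβpos : 0 < β := lt_of_lt_of_le (lt_of_lt_of_le one_pos (le_max_left _ _)) hβ
  have hterm : -(δ / 2) ≤ 2 * Real.log φ / (((d : ℝ) - 1) * N * β) := by
    have h1 : -4 * Real.log φ / (δ * K) ≤ β := (le_max_right _ _).trans hβ
    rw [div_le_iff₀ (by positivity)] at h1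
    rw [le_div_iff₀ (by positivity), ← hK]
    rw [hK] at h1
    linarith
  have hfloor_ge : Real.exp (-ε) ≤ 1 - 8 * r ^ 2 / N + 2 * Real.log φ / (((d : ℝ) - 1) * N * β) := by
    rw [hr2]
    have : Real.exp (-ε) = 1 - δ := by rw [hδ]; ring
    linarith
  have hfloor : 0 < 1 - 8 * r ^ 2 / N + 2 * Real.log φ / (((d : ℝ) - 1) * N * β) :=
    (Real.exp_pos _).trans_le hfloor_ge
  obtain ⟨hσ, hσ0, hσle⟩ := stringTension_le_linkBall ρ hd hN hρ hρU hβpos hr0 hfloor hμ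
  refine ⟨hσ, hσ0, hσle.trans ?_⟩
  have h := Real.log_le_log (Real.exp_pos _) hfloor_ge
  rw [Real.log_exp] at h
  linarith

end Limit

end Literature.MathematicalPhysics.QuantumFieldTheory

end
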